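import Summits.ResolutionOfSingularities.ResolutionOfSingularities.Theorems.FrobeniusLadderFInjectiveMacaulayficationFiniteGradedDescent
import HarnessLib

/-!
# Finite descent of the clause along a retraction — POINTWISE form (engine v2 «off orbits», brick (a))
# (crux `FInjectiveMacaulayfication` stmt-ResolutionOfSingularities-15315; RULING R15.48 (3) of res-L1-w45a-plan-1: relative filtered engine
# v2 `filteredConeFiModelRel_affineBlowup_offOrbits`, whose chain `affineBlowup_fiClause_of_cover` ← `filteredChartClause_v` ←
# `chartClause_core` ← `FiniteGradedDescent.stub_finiteGradedDescent` ← `coneFibreClause_v` has exactly one non-pointwise SIGNATURE,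
# the hypothesis «clause at EVERY maximal `Q ∋ b` of `B`» of `stub_finiteGradedDescent`/`chartClause_core`; this file removes it)

Support file (helper), chain w45a, seat res-L1-w45a-stub-4 g6. [OURS · L1 W4.5a] — NOT a statement of the manuscript; AI-written,
weaker than expert review.

`FiniteGradedDescent.stub_finiteGradedDescent` (E4, finite case; `A ⊆ B` a `k`-subalgebra, `B` Noetherian of characteristic `p` and
integral over `A`, `ρ : B → A` an `A`-linear retraction, all local rings of `A` and `B` at maximal ideals of dimension `m`) assumes the
clause at EVERY maximal ideal `Q ∋ b` of `B` and concludes it at every maximal `𝔫 ∋ b^N` of `A`.  Its proof uses the hypothesis only at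
the maximal ideals `Q` of `B` lying OVER `𝔫` (`comap_eq_of_maximal_among` + `Ideal.isMaximal_of_isIntegral_of_isMaximal_comap`).  This
file states that POINTWISE form, with the element `b` gone: **`clause_at_of_retract_of_over`** — if every maximal ideal `Q` of `B` with
`Q ∩ A = 𝔫` satisfies the clause, then `A_𝔫` satisfies the clause.  Proof body = the tree's, verbatim up to the one line that fed
`hclB Q hbQ` (now `hcl Q hQeq`).  The original is recovered by `hcl Q _ := hclB Q (b ∈ Q from b^N ∈ 𝔫)` (`finiteGradedDescent_of_at`).
No definitions, no named facts. [folklore]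
-/

-- single-problem summit: the doubled namespace component is forced
set_option linter.dupNamespace false

namespace Summit.ResolutionOfSingularities.ResolutionOfSingularities.Theorems.FInjectiveMacaulayfication.FiniteGradedDescentAt

open IsLocalRing RingTheory.Sequence Literature.RingTheory.TightClosure
open Summit.ResolutionOfSingularities.ResolutionOfSingularities.Theorems.FInjectiveMacaulayfication


/-- **FINITE DESCENT OF THE CLAUSE ALONG A RETRACTION, AT ONE MAXIMAL IDEAL.** `A ⊆ B` a `k`-subalgebra of a Noetherian ring of
characteristic `p`, `B` integral over `A`, `ρ : B → A` an `A`-linear retraction, all local rings of `A` and of `B` at maximal ideals of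
dimension `m`; `𝔫` a maximal ideal of `A`.  If `B_Q` satisfies the clause at every maximal ideal `Q` of `B` lying over `𝔫`
(`Q ∩ A = 𝔫`), then `A_𝔫` satisfies the clause. [folklore] -/
theorem clause_at_of_retract_of_over (p : ℕ) [Fact p.Prime] (k B : Type) [Field k] [CommRing B] [Algebra k B]
    [IsNoetherianRing B] [CharP B p] (A : Subalgebra k B) [Algebra.IsIntegral A B]
    (ρ : B →ₗ[A] A) (hρ : ∀ x : A, ρ (x : B) = x) (m : ℕ)
    (hdimB : ∀ (Q : Ideal B) [Q.IsMaximal], ringKrullDim (Localization.AtPrime Q) = m)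
    (hdimA : ∀ (𝔫 : Ideal A) [𝔫.IsMaximal], ringKrullDim (Localization.AtPrime 𝔫) = m)
    (𝔫 : Ideal A) [𝔫.IsMaximal]
    (hcl : ∀ (Q : Ideal B) [Q.IsMaximal], Q.comap (algebraMap A B) = 𝔫 →
      ∀ d : ℕ, ringKrullDim (Localization.AtPrime Q) = d → ∀ s : Fin d → Localization.AtPrime Q,
        (Ideal.span (Set.range s)).radical.IsMaximal →
          RingTheory.Sequence.IsWeaklyRegular (Localization.AtPrime Q) (List.ofFn s) ∧
          ∀ y : Localization.AtPrime Q, (∃ e : ℕ, y ^ p ^ e ∈ Ideal.span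
            ((fun z : Localization.AtPrime Q => z ^ p ^ e) ''
              (Ideal.span (Set.range s) : Set (Localization.AtPrime Q)))) → y ∈ Ideal.span (Set.range s)) :
    ∀ d : ℕ, ringKrullDim (Localization.AtPrime 𝔫) = d → ∀ s : Fin d → Localization.AtPrime 𝔫,
      (Ideal.span (Set.range s)).radical.IsMaximal →
        RingTheory.Sequence.IsWeaklyRegular (Localization.AtPrime 𝔫) (List.ofFn s) ∧
        ∀ y : Localization.AtPrime 𝔫, (∃ e : ℕ, y ^ p ^ e ∈ Ideal.span
          ((fun z : Localization.AtPrime 𝔫 => z ^ p ^ e) ''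
            (Ideal.span (Set.range s) : Set (Localization.AtPrime 𝔫)))) → y ∈ Ideal.span (Set.range s) := by
  have hρ1 : ρ 1 = 1 := by simpa using hρ 1
  have hinj : Function.Injective (algebraMap A B) := Subtype.val_injective
  haveI : CharP A p := (algebraMap A B).charP hinj p
  haveI : IsNoetherianRing A := DegreeZeroDescent.isNoetherianRing_of_retract ρ hρ1
  refine DegreeZeroDescent.inlineClause_localization_of_retract p ρ hρ1 𝔫 ?_
  intro d s hs Q _ hQn hQmax ψ hψ
  -- `Q ∩ A = 𝔫`, so `Q` is a maximal ideal of `B` over `𝔫`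
  have hQeq : Q.comap (algebraMap A B) = 𝔫 := FiniteGradedDescent.comap_eq_of_maximal_among 𝔫 Q hQn hQmax
  have hQAmax : (Q.comap (algebraMap A B)).IsMaximal := by
    rw [hQeq]
    infer_instance
  haveI hQm : Q.IsMaximal := Ideal.isMaximal_of_isIntegral_of_isMaximal_comap Q hQAmax
  -- `ψ` is the canonical local homomorphism `A_𝔫 → B_Q`
  have hψeq : Localization.localRingHom 𝔫 Q (algebraMap A B) hQeq.symm = ψ :=
    Localization.localRingHom_unique _ _ _ _ fun x => by
      have := RingHom.congr_fun hψ x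
      simpa using this
  have hsmax : ∀ i, s i ∈ maximalIdeal (Localization.AtPrime 𝔫) := fun i =>
    hs.2 ▸ Ideal.le_radical (Ideal.subset_span ⟨i, rfl⟩)
  have hψloc : ∀ i, ψ (s i) ∈ maximalIdeal (Localization.AtPrime Q) := fun i => by
    rw [← hψeq]
    exact map_nonunit _ _ (hsmax i)
  refine ⟨fun _ => ⟨hcl Q hQeq, 0, ?_, ?_⟩, fun ⟨i, hi⟩ => absurd (hψloc i) hi⟩
  · -- `dim B_Q = m = d`
    have hdm : (d : WithBot ℕ∞) = m := hs.1.symm.trans (hdimA 𝔫)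
    rw [Nat.add_zero, hdm]
    exact hdimB Q
  · -- `B_Q ⧸ (ψ s)` is zero-dimensional: its only prime is the maximal ideal
    set J : Ideal (Localization.AtPrime Q) := Ideal.span (Set.range fun i => ψ (s i)) with hJ
    have hJle : J ≤ maximalIdeal (Localization.AtPrime Q) := by
      rw [hJ, Ideal.span_le]
      rintro _ ⟨i, rfl⟩
      exact hψloc i
    have hJne : J ≠ ⊤ := fun h => (maximalIdeal.isMaximal _).ne_top (top_le_iff.mp (h ▸ hJle))
    haveI : Nontrivial (Localization.AtPrime Q ⧸ J) := Ideal.Quotient.nontrivial_iff.mpr hJne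
    have hprime : ∀ P : Ideal (Localization.AtPrime Q), P.IsPrime → J ≤ P →
        P = maximalIdeal (Localization.AtPrime Q) := by
      intro P hP hJP
      haveI := hP
      refine FiniteGradedDescent.eq_maximalIdeal_of_comap_eq 𝔫 Q ψ hψ P ?_
      have hsP : Ideal.span (Set.range s) ≤ P.comap ψ := by
        rw [Ideal.span_le]
        rintro _ ⟨i, rfl⟩
        exact hJP (Ideal.subset_span ⟨i, rfl⟩)
      have hmP : maximalIdeal (Localization.AtPrime 𝔫) ≤ P.comap ψ := by
        rw [← hs.2]
        exact (Ideal.IsPrime.radical_le_iff inferInstance).mpr hsP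
      exact ((maximalIdeal.isMaximal _).eq_of_le (Ideal.IsPrime.ne_top inferInstance) hmP).symm
    haveI : Ring.KrullDimLE 0 (Localization.AtPrime Q ⧸ J) := by
      refine Ideal.krullDimLE_zero_quotient_iff_forall_minimalPrimes_isMaximal.mpr fun P hP => ?_
      rw [hprime P hP.1.1 hP.1.2]
      exact maximalIdeal.isMaximal _
    rw [Nat.cast_zero]
    exact ringKrullDimZero_iff_ringKrullDim_eq_zero.mp inferInstance

/-- The tree's `FiniteGradedDescent.stub_finiteGradedDescent` recovered from the pointwise form: at a maximal `𝔫 ∋ b^N`, every maximal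
`Q` of `B` over `𝔫` contains `b`. [folklore] -/
theorem finiteGradedDescent_of_at (p : ℕ) [Fact p.Prime] (k B : Type) [Field k] [CommRing B] [Algebra k B]
    [IsNoetherianRing B] [CharP B p] (A : Subalgebra k B) [Algebra.IsIntegral A B]
    (ρ : B →ₗ[A] A) (hρ : ∀ x : A, ρ (x : B) = x) (b : B) (N m : ℕ) (hbN : b ^ N ∈ A)
    (hdimB : ∀ (Q : Ideal B) [Q.IsMaximal], ringKrullDim (Localization.AtPrime Q) = m)
    (hdimA : ∀ (𝔫 : Ideal A) [𝔫.IsMaximal], ringKrullDim (Localization.AtPrime 𝔫) = m)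
    (hclB : ∀ (Q : Ideal B) [Q.IsMaximal], b ∈ Q →
      ∀ d : ℕ, ringKrullDim (Localization.AtPrime Q) = d → ∀ s : Fin d → Localization.AtPrime Q,
        (Ideal.span (Set.range s)).radical.IsMaximal →
          RingTheory.Sequence.IsWeaklyRegular (Localization.AtPrime Q) (List.ofFn s) ∧
          ∀ y : Localization.AtPrime Q, (∃ e : ℕ, y ^ p ^ e ∈ Ideal.span
            ((fun z : Localization.AtPrime Q => z ^ p ^ e) ''
              (Ideal.span (Set.range s) : Set (Localization.AtPrime Q)))) → y ∈ Ideal.span (Set.range s))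
    (𝔫 : Ideal A) [𝔫.IsMaximal] (hb𝔫 : (⟨b ^ N, hbN⟩ : A) ∈ 𝔫) :
    ∀ d : ℕ, ringKrullDim (Localization.AtPrime 𝔫) = d → ∀ s : Fin d → Localization.AtPrime 𝔫,
      (Ideal.span (Set.range s)).radical.IsMaximal →
        RingTheory.Sequence.IsWeaklyRegular (Localization.AtPrime 𝔫) (List.ofFn s) ∧
        ∀ y : Localization.AtPrime 𝔫, (∃ e : ℕ, y ^ p ^ e ∈ Ideal.span
          ((fun z : Localization.AtPrime 𝔫 => z ^ p ^ e) ''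
            (Ideal.span (Set.range s) : Set (Localization.AtPrime 𝔫)))) → y ∈ Ideal.span (Set.range s) := by
  refine clause_at_of_retract_of_over p k B A ρ hρ m hdimB hdimA 𝔫 fun Q _ hQeq => hclB Q ?_
  have h1 : algebraMap A B ⟨b ^ N, hbN⟩ ∈ Q := by
    rw [← Ideal.mem_comap, hQeq]
    exact hb𝔫
  exact Ideal.IsPrime.mem_of_pow_mem inferInstance N h1

end Summit.ResolutionOfSingularities.ResolutionOfSingularities.Theorems.FInjectiveMacaulayfication.FiniteGradedDescentAt
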